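import Literature.Computability.Complexity.PaulPippengerSzemerediTrotter1983Padding
import Literature.Computability.Complexity.PaulPippengerSzemerediTrotter1983
import Literature.Computability.Complexity.TimeConstructibleClosure
import Literature.Computability.Complexity.MurrayWilliams2018Lemma13
import Literature.Computability.Complexity.NTIMEPadding
import Literature.Computability.Complexity.NPEqUnionNTIME
import Literature.Computability.Complexity.NSubexp
import Literature.Computability.Complexity.Unambiguous
import Literature.Computability.Complexity.UPClosureProofs
import HarnessLib

/-!
# Padding for unambiguous time: `NP ≠ UP ⟹ NTIME(n) ⊄ UTIME(nᵏ)` for every `k`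

The translation ("padding") lemma of Book, Paul–Pippenger–Szemerédi–Trotter and the textbooks
(Arora–Barak 2009, §2.6.2) in its UNAMBIGUOUS form: if nondeterministic linear time were contained
in unambiguous time `nᵏ` for ONE exponent `k`, then `NP ⊆ UP`, i.e. `NP = UP`. Contrapositively the
conjecture `NP ≠ UP` (Valiant 1976; the summit-side conjecture node of `PneNP`) implies EVERY rung of
the unambiguous linear-time ladder `NTIME(n) ⊄ UTIME(nᵏ)`, whose rung `k = 1` — "NLIN ≠ ULIN",
whether unambiguous computation has nontrivial time hierarchy theorems being open (Hemaspaandra–Rothe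
1997, §1) — is the crux `NlinNotInUlin` of route `Summits/PneNP/PneNP/Theses/NtimeNotUnambiguousLadder.lean`,
and whose "rung ⟹ all rungs" crux `LadderClimbU` is therefore `NP ≠ UP` in costume
(barrier ladder `Literature/Barriers/PneNP/Ladder.lean` §2H R-I1: "multitape: all `c` ⟺ `NP ≠ UP`").

Proof (the `U`-copy of `Summit.PneNP.PneNP.Theorems.soloInformed_NP_subset_P_of_NTIME_id_subset_DTIME_pow`,
whose two machine lemmas are HOISTED here because a Literature file cannot import `Summits.*`): for
`L ∈ NP` take `D ≥ 1` with `L ∈ NTIME(nᴰ)` (`exists_mem_NTIME_pow_pos_of_mem_NP`); the padded language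
`padLin (nᴰ) L = {⟨x, 1^{|x|ᴰ}⟩ : x ∈ L} ∈ NTIME(n)` (`padLin_mem_NTIME_id`, with the linear-time clock
`timeComputable_pow_linear`), hence in `UTIME(nᵏ) ⊆ UP` (`UTIME_pow_subset_UP`), and
`L = (polyPad D)⁻¹(padLin (nᴰ) L)` with `polyPad D ∈ FP`, so `L ∈ UP` because `UP` is closed under
Karp reductions (`preimage_mem_UP`).

* `timeComputable_pow_linear` — `1ⁿ ↦ bin(nᴰ)` in time `O(n)` (hoisted
  `soloInformed_timeComputable_pow_linear`);
* `exists_mem_NTIME_pow_pos_of_mem_NP` — `L ∈ NP → ∃ D ≥ 1, L ∈ NTIME(nᴰ)` (hoisted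
  `soloInformed_exists_mem_NTIME_pow_pos_of_mem_NP`);
* `NP_subset_UP_of_NTIME_id_subset_UTIME_pow` — `NTIME(n) ⊆ UTIME(nᵏ) → NP ⊆ UP`;
* `NP_eq_UP_of_NTIME_id_subset_UTIME_pow` — `… → NP = UP`;
* `not_NTIME_id_subset_UTIME_pow_of_NP_ne_UP` — `NP ≠ UP → ∀ k, ¬ (NTIME(n) ⊆ UTIME(nᵏ))`;
* `uLadder_of_NP_ne_UP` — the same in the route's `ULadder` shape `∀ c, 1 ≤ c → ¬ (…)`.

References: S. Arora, B. Barak, *Computational Complexity: A Modern Approach* (2009), §1.3 (time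
constructibility), Thm. 2.6, §2.6.2 (padding) [AroraBarakCC2009]; W. Paul, N. Pippenger,
E. Szemerédi, W. Trotter, FOCS 1983 [PaulEtAl1983]; L. G. Valiant, Inform. Process. Lett. 5 (1976)
[Valiant1976]; L. Hemaspaandra, J. Rothe, SIAM J. Comput. 26 (1997), §1 [HemaspaandraRothe1997].
All ingredients are tree theorems; standard axioms only.
-/

namespace Literature.Computability.Complexity

open _root_.Computability Turing Polynomial Brick

/-! ### Binary numerals of powers in linear time (hoisted from the `PneNP` soloist ladder file) -/

/-- **`1ⁿ ↦ bin(nᴰ)` in time `O(n)`**: the unary-to-binary converter of the tree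
(`timeComputable_unary_id`, `28 n + 28` steps) followed by the `FP` numeral map `powNumFn D`
(`bin T ↦ bin(Tᴰ)`), whose running time is a polynomial in `|bin n| ≤ log₂ n + 1`, hence `O(n)`.
Verbatim `Summit.PneNP.PneNP.Theorems.soloInformed_timeComputable_pow_linear`, hoisted to Literature.
[cite: AroraBarakCC2009, §1.3 (p. 16)] -/
theorem timeComputable_pow_linear (D : ℕ) :
    ∃ C : ℕ, TimeComputable unaryEncodeNat encodeNat (fun n : ℕ => n ^ D) (fun n => C * n + C) := by
  obtain ⟨Mt, hMt⟩ := timeComputable_unary_id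
  obtain ⟨p, MA, hMA⟩ := powNumFn_mem_FP D
  obtain ⟨c₁, k, hk⟩ := exists_eval_le_mul_pow_add p
  obtain ⟨C, hC⟩ := TimeConstructible.exists_pow_le_mul_two_pow k
  refine ⟨28 + 2 * (c₁ * C) + c₁, Mt.comp MA, fun n => ?_⟩
  have hl : (unaryEncodeNat n).length = n := unary_decode_encode_nat n
  have h1 : Mt.OutputsWithin (unaryEncodeNat n) (encodeNat n) (28 * n + 28) := by
    have := hMt n
    dsimp only at this
    rwa [hl] at this
  have h2 : MA.OutputsWithin (encodeNat n) (encodeNat (n ^ D)) (p.eval (encodeNat n).length) := by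
    have := hMA (encodeNat n)
    rwa [powNumFn_encodeNat] at this
  have h := Turing.TM2ComputableAux.comp_outputsWithin _ _ h1 h2
  dsimp only
  rw [hl]
  refine h.mono ?_
  have hm : (encodeNat n).length ≤ Nat.log 2 n + 1 := TM2Pass.length_encodeNat_le n
  have h2m : 2 ^ (encodeNat n).length ≤ 2 * (n + 1) :=
    calc 2 ^ (encodeNat n).length ≤ 2 ^ (Nat.log 2 n + 1) := Nat.pow_le_pow_right Nat.two_pos hm
      _ = 2 * 2 ^ Nat.log 2 n := by rw [pow_succ, mul_comm]
      _ ≤ 2 * (n + 1) := Nat.mul_le_mul_left 2 (Nat.pow_log_le_add_one 2 n)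
  have hp : p.eval (encodeNat n).length ≤ c₁ * (C * (2 * (n + 1))) + c₁ :=
    (hk _).trans (by
      gcongr
      exact (hC _).trans (Nat.mul_le_mul_left C h2m))
  have e1 : c₁ * (C * (2 * (n + 1))) = 2 * (c₁ * C) * n + 2 * (c₁ * C) := by ring
  have e2 : (28 + 2 * (c₁ * C) + c₁) * n = 28 * n + 2 * (c₁ * C) * n + c₁ * n := by ring
  omega

/-! ### From `NP` to `NTIME(nᴰ)` with `D ≥ 1` (hoisted) -/

/-- **Every `NP` language is in some `NTIME(nᴰ)` with `D ≥ 1`.** `NP ⊆ ⋃ₖ NTIME(nᵏ)`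
(`NP_subset_iUnion_NTIME`); the degenerate exponent `k = 0` (constant-time verifiers) is
transported into `NTIME(nᵉ)`, `e ≥ 1`, by the truncating transport of verifiers
(`NVerifier.exists_transport`) along the polynomial-time pair clock `x ↦ ⟨x, 1^{2c}⟩`
(`exists_machine_pair_ones_mul_pow_add`). Verbatim
`Summit.PneNP.PneNP.Theorems.soloInformed_exists_mem_NTIME_pow_pos_of_mem_NP`, hoisted to Literature.
[cite: AroraBarakCC2009, Thm. 2.6] -/
theorem exists_mem_NTIME_pow_pos_of_mem_NP {L : Language Bool}
    (hL : L ∈ Nondeterministic.NP) : ∃ D : ℕ, 1 ≤ D ∧ L ∈ NTIME (fun n => n ^ D) := by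
  obtain ⟨k, hk⟩ := Set.mem_iUnion.1 (NP_subset_iUnion_NTIME hL)
  rcases Nat.eq_zero_or_pos k with rfl | hk1
  · obtain ⟨V⟩ := mem_NTIME_iff_nonempty_nVerifier.1 hk
    obtain ⟨q, N, hN⟩ := exists_machine_pair_ones_mul_pow_add V.c 0
    obtain ⟨A, e, hq⟩ := exists_eval_le_mul_pow_add q
    have hpow : ∀ n : ℕ, n ^ e ≤ n ^ (e + 1) + 1 := by
      intro n
      rcases Nat.eq_zero_or_pos n with rfl | hpos
      · cases e <;> simp
      · exact (Nat.pow_le_pow_right hpos (Nat.le_succ e)).trans (Nat.le_succ _)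
    have hdom : ∀ n : ℕ, q.eval n ≤ (2 * A + 2 * V.c + 1) * n ^ (e + 1) + (2 * A + 2 * V.c + 1) := by
      intro n
      have h1 := hq n
      have h2 : A * n ^ e ≤ A * (n ^ (e + 1) + 1) := Nat.mul_le_mul_left A (hpow n)
      have e1 : A * (n ^ (e + 1) + 1) = A * n ^ (e + 1) + A := by ring
      have e2 : (2 * A + 2 * V.c + 1) * n ^ (e + 1) =
          A * n ^ (e + 1) + A * n ^ (e + 1) + 2 * V.c * n ^ (e + 1) + n ^ (e + 1) := by ring
      omega
    obtain ⟨V', -⟩ := V.exists_transport (t₂ := fun n => n ^ (e + 1)) N (2 * A + 2 * V.c + 1)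
      (fun x => (hN x).mono (hdom _))
      (fun n => by simp only [pow_zero, mul_one]; omega)
      (fun n => by
        have h1 : n ≤ n ^ (e + 1) := Nat.le_self_pow (Nat.succ_ne_zero e) n
        have h2 : n ^ (e + 1) ≤ (2 * A + 2 * V.c + 1) * n ^ (e + 1) :=
          Nat.le_mul_of_pos_left _ (by omega)
        omega)
    exact ⟨e + 1, Nat.succ_pos e, mem_NTIME_iff_nonempty_nVerifier.2 ⟨V'⟩⟩
  · exact ⟨k, hk1, hk⟩

/-! ### Downward translation for unambiguous time -/

/-- **If `NTIME(n) ⊆ UTIME(nᵏ)` for ONE `k` then `NP ⊆ UP`** (padding, Arora–Barak 2009, §2.6.2,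
in Valiant's class): for `L ∈ NP`, `L ∈ NTIME(nᴰ)` with `D ≥ 1`; `padLin (nᴰ) L ∈ NTIME(n)`
(`padLin_mem_NTIME_id`, clock `timeComputable_pow_linear`) is then in `UTIME(nᵏ) ⊆ UP`
(`UTIME_pow_subset_UP`), and `L = (polyPad D)⁻¹ (padLin (nᴰ) L)` with `polyPad D ∈ FP`
(`pad_mem_padLin`, `polyPad_mem_FP`), so `L ∈ UP` (`preimage_mem_UP`).
[cite: AroraBarakCC2009, §2.6.2 (padding)] [cite: Valiant1976] -/
theorem NP_subset_UP_of_NTIME_id_subset_UTIME_pow {k : ℕ}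
    (h : NTIME (fun n => n) ⊆ UTIME (fun n => n ^ k)) : Nondeterministic.NP ⊆ UP := by
  intro L hL
  obtain ⟨D, hD, hLD⟩ := exists_mem_NTIME_pow_pos_of_mem_NP hL
  obtain ⟨C, hC⟩ := timeComputable_pow_linear D
  have hid : ∀ n : ℕ, n ≤ n ^ D := fun n => Nat.le_self_pow (by omega) n
  have hpad : padLin (fun n => n ^ D) L ∈ NTIME (fun n => n) := padLin_mem_NTIME_id hC hid hLD
  have hUP : padLin (fun n => n ^ D) L ∈ UP := UTIME_pow_subset_UP k (h hpad)
  have hred : (polyPad D) ⁻¹' padLin (fun n => n ^ D) L = L := by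
    ext x
    simp only [Set.mem_preimage, polyPad]
    exact pad_mem_padLin
  rw [← hred]
  exact preimage_mem_UP hUP (polyPad_mem_FP D)

/-- **`NTIME(n) ⊆ UTIME(nᵏ)` for one `k` collapses `NP = UP`** (`UP ⊆ NP` is `UP_subset_NP`).
[cite: AroraBarakCC2009, §2.6.2 (padding)] -/
theorem NP_eq_UP_of_NTIME_id_subset_UTIME_pow {k : ℕ}
    (h : NTIME (fun n => n) ⊆ UTIME (fun n => n ^ k)) : Nondeterministic.NP = UP :=
  Set.Subset.antisymm (NP_subset_UP_of_NTIME_id_subset_UTIME_pow h) UP_subset_NP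

/-- **`NP ≠ UP ⟹` every rung of the unambiguous linear-time ladder**: `∀ k, NTIME(n) ⊄ UTIME(nᵏ)`.
With this in scope a route crux of the shape "`NTIME(n) ⊄ UTIME(n)` ⟹ all rungs" closes from the
hypothesis `NP ≠ UP` in one line, `fun h _ k _ => not_NTIME_id_subset_UTIME_pow_of_NP_ne_UP h k`
(tribunal T1, rule (a): the crux is `NP ≠ UP` in costume). [cite: AroraBarakCC2009, §2.6.2 (padding)]
[cite: HemaspaandraRothe1997, §1] -/
theorem not_NTIME_id_subset_UTIME_pow_of_NP_ne_UP (h : Nondeterministic.NP ≠ UP) (k : ℕ) :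
    ¬ (NTIME (fun n => n) ⊆ UTIME (fun n => n ^ k)) :=
  fun hsub => h (NP_eq_UP_of_NTIME_id_subset_UTIME_pow hsub)

/-- The same in the shape of the route decl `NtimeNotUnambiguousLadder.ULadder`
(`∀ c, 1 ≤ c → ¬ (NTIME(n) ⊆ UTIME(nᶜ))`; the side condition `1 ≤ c` is not needed).
[cite: AroraBarakCC2009, §2.6.2 (padding)] -/
theorem uLadder_of_NP_ne_UP (h : Nondeterministic.NP ≠ UP) :
    ∀ c : ℕ, 1 ≤ c → ¬ (NTIME (fun n : ℕ => n) ⊆ UTIME (fun n : ℕ => n ^ c)) :=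
  fun c _ => not_NTIME_id_subset_UTIME_pow_of_NP_ne_UP h c

end Literature.Computability.Complexity
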